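import Literature.MathematicalPhysics.QuantumLattice.FrozenEnvironmentWords
import Literature.MathematicalPhysics.QuantumChemistry.PositivityConditions
import HarnessLib

/-!
# The reduced density matrices of a frozen-core wave function

Topic `Literature/MathematicalPhysics/QuantumChemistry`. For the frozen-environment isometry
`V_K = frozenEmbed e K : 𝔉(ι) → 𝔉(ι')` (`QuantumLattice/FrozenEnvironmentEmbedding.lean`: the image
spin orbitals `e ι` active, the environment spin orbitals of `K` occupied, the others empty) the one- and
two-particle reduced density matrices (`oneRDM`, `twoRDM` of `PositivityConditions.lean`, Mazziotti (2007)
(11), (16)) of a frozen-core wave function `V_K ψ` are read off block by block from those of its active part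
`ψ` — the density-matrix form of the frozen-core reduction (Helgaker–Jørgensen–Olsen (2000) §12.5.1, after
(12.5.8): with inactive orbitals doubly occupied "the only two-electron density-matrix elements now needed
are those with all four indices active"; (1.7.17), (1.7.33) for the occupied-orbital blocks):

* `¹D`: active block `¹D(V_K ψ)_{ei,ej} = ¹D(ψ)_{ij}`; environment block `¹D(V_K ψ)_{kk'} = [k = k' ∈ K] ⟨ψ,ψ⟩`;
  mixed blocks `0`;
* `²D` (rows `(a, b)`, columns `(c, d)`, entry `⟨a†_a a†_b a_d a_c⟩`): all-active block `= ²D(ψ)`;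
  the COULOMB blocks `²D_{(ei,k),(ej,k')} = ²D_{(k,ei),(k',ej)} = [k = k' ∈ K] ¹D(ψ)_{ij}`; the EXCHANGE
  blocks `²D_{(ei,k),(k',ej)} = ²D_{(k,ei),(ej,k')} = −[k = k' ∈ K] ¹D(ψ)_{ij}`; the environment block
  `²D_{(k₁,k₃),(k₂,k₄)} = ([k₃ = k₄][k₁ = k₂] − [k₁ = k₄][k₃ = k₂]) [k₁, k₃ ∈ K] ⟨ψ,ψ⟩` (the two-matrix of
  the occupation vector `|K⟩`, HJO (1.7.33)); every block with an ODD number of environment indices, and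
  the blocks with two environment CREATORS or two environment ANNIHILATORS only, vanish.

All statements are the expectation values `⟨V_K ψ| string |V_K ψ⟩ = ⟨ψ| V_Kᴴ string V_K |ψ⟩` of the sixteen
pattern lemmas of `QuantumLattice/FrozenEnvironmentWords.lean`; PROVED, 0 sorry, no definition.

References: T. Helgaker, P. Jørgensen, J. Olsen, *Molecular Electronic-Structure Theory* (Wiley 2000),
eqs. (1.7.17), (1.7.33), §12.5.1 (12.5.7)–(12.5.14) [HelgakerJorgensenOlsen2000]; D. A. Mazziotti, Adv.
Chem. Phys. 134 (2007) ch. 3, eqs. (11), (16) [Mazziotti2007RDMChapter]; E. Koridon et al., Phys. Rev.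
Research 3 (2021) 033127, App. A [KoridonEtAl2021].
-/

noncomputable section

namespace Literature.MathematicalPhysics.QuantumChemistry

open Matrix Finset Literature.MathematicalPhysics.QuantumLattice JWEmbed

variable {ι ι' : Type*} [LinearOrder ι] [LinearOrder ι'] [Fintype ι] [Fintype ι']
variable (e : ι ↪o ι') {K : Finset ι'}

/-- Expectation values in a frozen-core wave function are expectation values of the compressed operator
(private bookkeeping). [folklore] -/
private theorem expect_frozenEmbed (A : Matrix (Finset ι') (Finset ι') ℂ) (ψ : Fock ι) :
    star (frozenEmbed e K *ᵥ ψ) ⬝ᵥ A *ᵥ (frozenEmbed e K *ᵥ ψ) =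
      star ψ ⬝ᵥ ((frozenEmbed e K)ᴴ * A * frozenEmbed e K) *ᵥ ψ := by
  rw [star_mulVec, ← dotProduct_mulVec, mulVec_mulVec, mulVec_mulVec]

/-! ### The one-matrix -/

/-- **Active block of `¹D`**: `¹D(V_K ψ)_{ei,ej} = ¹D(ψ)_{ij}`.
[cite: HelgakerJorgensenOlsen2000, §12.5.1 eqs. (12.5.9)-(12.5.12) (inactive/active blocks of the density matrices)] -/
theorem oneRDM_frozenEmbed_mulVec_apply_apply (hK : Disjoint K (rangeF e)) (ψ : Fock ι) (i j : ι) :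
    oneRDM (frozenEmbed e K *ᵥ ψ) (e i) (e j) = oneRDM ψ i j := by
  simp only [oneRDM, expect_frozenEmbed, sandwichOne_II e hK]

/-- **Environment block of `¹D`**: `¹D(V_K ψ)_{kk'} = [k = k' ∈ K] ⟨ψ, ψ⟩` (frozen orbitals have occupation
one, the others zero, no coherences). [cite: HelgakerJorgensenOlsen2000, eq. (1.7.17)] -/
theorem oneRDM_frozenEmbed_mulVec_env_env (hK : Disjoint K (rangeF e)) (ψ : Fock ι) {k k' : ι'}
    (hk : k ∉ rangeF e) (hk' : k' ∉ rangeF e) :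
    oneRDM (frozenEmbed e K *ᵥ ψ) k k' = if k = k' ∧ k ∈ K then star ψ ⬝ᵥ ψ else 0 := by
  simp only [oneRDM, expect_frozenEmbed, sandwichOne_EE e hK hk hk']
  split_ifs
  · rw [one_mulVec]
  · rw [zero_mulVec, dotProduct_zero]

/-- **Mixed blocks of `¹D` vanish**: `¹D(V_K ψ)_{ei,k} = 0`. [cite: HelgakerJorgensenOlsen2000, §12.5.1 eqs. (12.5.9)-(12.5.12) (inactive/active blocks of the density matrices)] -/
theorem oneRDM_frozenEmbed_mulVec_apply_env (hK : Disjoint K (rangeF e)) (ψ : Fock ι) (i : ι) {k : ι'}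
    (hk : k ∉ rangeF e) : oneRDM (frozenEmbed e K *ᵥ ψ) (e i) k = 0 := by
  simp only [oneRDM, expect_frozenEmbed, sandwichOne_IE e hK hk, zero_mulVec, dotProduct_zero]

/-- **Mixed blocks of `¹D` vanish**: `¹D(V_K ψ)_{k,ej} = 0`. [cite: HelgakerJorgensenOlsen2000, §12.5.1 eqs. (12.5.9)-(12.5.12) (inactive/active blocks of the density matrices)] -/
theorem oneRDM_frozenEmbed_mulVec_env_apply (hK : Disjoint K (rangeF e)) (ψ : Fock ι) (j : ι) {k : ι'}
    (hk : k ∉ rangeF e) : oneRDM (frozenEmbed e K *ᵥ ψ) k (e j) = 0 := by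
  simp only [oneRDM, expect_frozenEmbed, sandwichOne_EI e hK hk, zero_mulVec, dotProduct_zero]

/-! ### The two-matrix: live blocks -/

/-- **All-active block of `²D`**: `²D(V_K ψ)_{(ei,ek),(ej,el)} = ²D(ψ)_{(i,k),(j,l)}`.
[cite: HelgakerJorgensenOlsen2000, §12.5.1 (after (12.5.14): only all-active two-electron density-matrix elements are needed)] -/
theorem twoRDM_frozenEmbed_mulVec_active (hK : Disjoint K (rangeF e)) (ψ : Fock ι) (i k j l : ι) :
    twoRDM (frozenEmbed e K *ᵥ ψ) (e i, e k) (e j, e l) = twoRDM ψ (i, k) (j, l) := by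
  simp only [twoRDM, expect_frozenEmbed, sandwichTwo_IIII e hK]

/-- **Coulomb block** `²D(V_K ψ)_{(ei,k),(ej,k')} = [k = k' ∈ K] ¹D(ψ)_{ij}`.
[cite: HelgakerJorgensenOlsen2000, eq. (12.5.12) (the Coulomb term of the inactive Fock matrix)] -/
theorem twoRDM_frozenEmbed_mulVec_apply_env_apply_env (hK : Disjoint K (rangeF e)) (ψ : Fock ι) (i j : ι)
    {k k' : ι'} (hk : k ∉ rangeF e) (hk' : k' ∉ rangeF e) :
    twoRDM (frozenEmbed e K *ᵥ ψ) (e i, k) (e j, k') = if k = k' ∧ k ∈ K then oneRDM ψ i j else 0 := by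
  simp only [twoRDM, oneRDM, expect_frozenEmbed, sandwichTwo_IEEI e hK hk hk']
  split_ifs
  · rfl
  · rw [zero_mulVec, dotProduct_zero]

/-- **Coulomb block** `²D(V_K ψ)_{(k,ei),(k',ej)} = [k = k' ∈ K] ¹D(ψ)_{ij}`.
[cite: HelgakerJorgensenOlsen2000, eq. (12.5.12) (the Coulomb term of the inactive Fock matrix)] -/
theorem twoRDM_frozenEmbed_mulVec_env_apply_env_apply (hK : Disjoint K (rangeF e)) (ψ : Fock ι) (i j : ι)
    {k k' : ι'} (hk : k ∉ rangeF e) (hk' : k' ∉ rangeF e) :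
    twoRDM (frozenEmbed e K *ᵥ ψ) (k, e i) (k', e j) = if k = k' ∧ k ∈ K then oneRDM ψ i j else 0 := by
  simp only [twoRDM, oneRDM, expect_frozenEmbed, sandwichTwo_EIIE e hK hk hk']
  split_ifs
  · rfl
  · rw [zero_mulVec, dotProduct_zero]

/-- **Exchange block** `²D(V_K ψ)_{(ei,k),(k',ej)} = −[k = k' ∈ K] ¹D(ψ)_{ij}`.
[cite: HelgakerJorgensenOlsen2000, eq. (12.5.12) (the exchange term of the inactive Fock matrix)] -/
theorem twoRDM_frozenEmbed_mulVec_apply_env_env_apply (hK : Disjoint K (rangeF e)) (ψ : Fock ι) (i j : ι)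
    {k k' : ι'} (hk : k ∉ rangeF e) (hk' : k' ∉ rangeF e) :
    twoRDM (frozenEmbed e K *ᵥ ψ) (e i, k) (k', e j) = if k = k' ∧ k ∈ K then -oneRDM ψ i j else 0 := by
  simp only [twoRDM, oneRDM, expect_frozenEmbed, sandwichTwo_IEIE e hK hk' hk]
  split_ifs
  · rw [neg_mulVec, dotProduct_neg]
  · rw [zero_mulVec, dotProduct_zero]

/-- **Exchange block** `²D(V_K ψ)_{(k,ei),(ej,k')} = −[k = k' ∈ K] ¹D(ψ)_{ij}`.
[cite: HelgakerJorgensenOlsen2000, eq. (12.5.12) (the exchange term of the inactive Fock matrix)] -/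
theorem twoRDM_frozenEmbed_mulVec_env_apply_apply_env (hK : Disjoint K (rangeF e)) (ψ : Fock ι) (i j : ι)
    {k k' : ι'} (hk : k ∉ rangeF e) (hk' : k' ∉ rangeF e) :
    twoRDM (frozenEmbed e K *ᵥ ψ) (k, e i) (e j, k') = if k = k' ∧ k ∈ K then -oneRDM ψ i j else 0 := by
  simp only [twoRDM, oneRDM, expect_frozenEmbed, sandwichTwo_EIEI e hK hk hk']
  split_ifs
  · rw [neg_mulVec, dotProduct_neg]
  · rw [zero_mulVec, dotProduct_zero]

/-- **Environment block** (the two-matrix of the occupation vector `|K⟩` times `⟨ψ,ψ⟩`):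
`²D(V_K ψ)_{(k₁,k₃),(k₂,k₄)} = ([k₃ = k₄][k₁ = k₂] − [k₁ = k₄][k₃ = k₂]) [k₁, k₃ ∈ K] ⟨ψ,ψ⟩`.
[cite: HelgakerJorgensenOlsen2000, eq. (1.7.33)] -/
theorem twoRDM_frozenEmbed_mulVec_env (hK : Disjoint K (rangeF e)) (ψ : Fock ι) {k₁ k₂ k₃ k₄ : ι'}
    (h₁ : k₁ ∉ rangeF e) (h₂ : k₂ ∉ rangeF e) (h₃ : k₃ ∉ rangeF e) (h₄ : k₄ ∉ rangeF e) :
    twoRDM (frozenEmbed e K *ᵥ ψ) (k₁, k₃) (k₂, k₄) =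
      ((if k₃ = k₄ ∧ k₁ = k₂ ∧ k₁ ∈ K ∧ k₃ ∈ K then (1 : ℂ) else 0) -
        (if k₁ = k₄ ∧ k₃ = k₂ ∧ k₁ ∈ K ∧ k₃ ∈ K then (1 : ℂ) else 0)) * (star ψ ⬝ᵥ ψ) := by
  simp only [twoRDM, expect_frozenEmbed, sandwichTwo_EEEE e hK h₁ h₂ h₃ h₄, Matrix.smul_mulVec, one_mulVec,
    dotProduct_smul, smul_eq_mul]

/-! ### The two-matrix: dead blocks -/

/-- One environment index among four: `²D(V_K ψ)_{(ei,ek),(ej,m)} = 0`. [cite: KoridonEtAl2021, App. A eqs. (A2)-(A3) (projection onto |Φ_frozen Φ_active⟩)] -/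
theorem twoRDM_frozenEmbed_mulVec_IIEI (hK : Disjoint K (rangeF e)) (ψ : Fock ι) (i k j : ι) {m : ι'}
    (hm : m ∉ rangeF e) : twoRDM (frozenEmbed e K *ᵥ ψ) (e i, e k) (e j, m) = 0 := by
  simp only [twoRDM, expect_frozenEmbed, sandwichTwo_IIEI e hK hm, zero_mulVec, dotProduct_zero]

/-- One environment index among four: `²D(V_K ψ)_{(ei,ek),(m,el)} = 0`. [cite: KoridonEtAl2021, App. A eqs. (A2)-(A3) (projection onto |Φ_frozen Φ_active⟩)] -/
theorem twoRDM_frozenEmbed_mulVec_IIIE (hK : Disjoint K (rangeF e)) (ψ : Fock ι) (i k l : ι) {m : ι'}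
    (hm : m ∉ rangeF e) : twoRDM (frozenEmbed e K *ᵥ ψ) (e i, e k) (m, e l) = 0 := by
  simp only [twoRDM, expect_frozenEmbed, sandwichTwo_IIIE e hK hm, zero_mulVec, dotProduct_zero]

/-- One environment index among four: `²D(V_K ψ)_{(ei,m),(ej,el)} = 0`. [cite: KoridonEtAl2021, App. A eqs. (A2)-(A3) (projection onto |Φ_frozen Φ_active⟩)] -/
theorem twoRDM_frozenEmbed_mulVec_IEII (hK : Disjoint K (rangeF e)) (ψ : Fock ι) (i j l : ι) {m : ι'}
    (hm : m ∉ rangeF e) : twoRDM (frozenEmbed e K *ᵥ ψ) (e i, m) (e j, e l) = 0 := by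
  simp only [twoRDM, expect_frozenEmbed, sandwichTwo_IEII e hK hm, zero_mulVec, dotProduct_zero]

/-- One environment index among four: `²D(V_K ψ)_{(m,ek),(ej,el)} = 0`. [cite: KoridonEtAl2021, App. A eqs. (A2)-(A3) (projection onto |Φ_frozen Φ_active⟩)] -/
theorem twoRDM_frozenEmbed_mulVec_EIII (hK : Disjoint K (rangeF e)) (ψ : Fock ι) (k j l : ι) {m : ι'}
    (hm : m ∉ rangeF e) : twoRDM (frozenEmbed e K *ᵥ ψ) (m, e k) (e j, e l) = 0 := by
  simp only [twoRDM, expect_frozenEmbed, sandwichTwo_EIII e hK hm, zero_mulVec, dotProduct_zero]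

/-- Two environment annihilators: `²D(V_K ψ)_{(ei,ek),(m,m')} = 0`. [cite: KoridonEtAl2021, App. A eqs. (A2)-(A3) (projection onto |Φ_frozen Φ_active⟩)] -/
theorem twoRDM_frozenEmbed_mulVec_IIEE (hK : Disjoint K (rangeF e)) (ψ : Fock ι) (i k : ι) {m : ι'}
    (m' : ι') (hm : m ∉ rangeF e) : twoRDM (frozenEmbed e K *ᵥ ψ) (e i, e k) (m, m') = 0 := by
  simp only [twoRDM, expect_frozenEmbed, sandwichTwo_IIEE e hK hm m', zero_mulVec, dotProduct_zero]

/-- Two environment creators: `²D(V_K ψ)_{(m,m'),(ej,el)} = 0`. [cite: KoridonEtAl2021, App. A eqs. (A2)-(A3) (projection onto |Φ_frozen Φ_active⟩)] -/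
theorem twoRDM_frozenEmbed_mulVec_EEII (hK : Disjoint K (rangeF e)) (ψ : Fock ι) (j l : ι) {m : ι'}
    (m' : ι') (hm : m ∉ rangeF e) : twoRDM (frozenEmbed e K *ᵥ ψ) (m, m') (e j, e l) = 0 := by
  simp only [twoRDM, expect_frozenEmbed, sandwichTwo_EEII e hK hm m', zero_mulVec, dotProduct_zero]

/-- Three environment indices: `²D(V_K ψ)_{(m₁,m₃),(m₂,el)} = 0`. [cite: KoridonEtAl2021, App. A eqs. (A2)-(A3) (projection onto |Φ_frozen Φ_active⟩)] -/
theorem twoRDM_frozenEmbed_mulVec_EEIE (hK : Disjoint K (rangeF e)) (ψ : Fock ι) (l : ι) {m₁ m₂ m₃ : ι'}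
    (h₁ : m₁ ∉ rangeF e) (h₂ : m₂ ∉ rangeF e) (h₃ : m₃ ∉ rangeF e) :
    twoRDM (frozenEmbed e K *ᵥ ψ) (m₁, m₃) (m₂, e l) = 0 := by
  simp only [twoRDM, expect_frozenEmbed, sandwichTwo_EEIE e hK h₁ h₂ h₃, zero_mulVec, dotProduct_zero]

/-- Three environment indices: `²D(V_K ψ)_{(m₁,ek),(m₂,m₄)} = 0`. [cite: KoridonEtAl2021, App. A eqs. (A2)-(A3) (projection onto |Φ_frozen Φ_active⟩)] -/
theorem twoRDM_frozenEmbed_mulVec_EIEE (hK : Disjoint K (rangeF e)) (ψ : Fock ι) (k : ι) (m₁ : ι')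
    {m₂ m₄ : ι'} (h₂ : m₂ ∉ rangeF e) (h₄ : m₄ ∉ rangeF e) :
    twoRDM (frozenEmbed e K *ᵥ ψ) (m₁, e k) (m₂, m₄) = 0 := by
  simp only [twoRDM, expect_frozenEmbed, sandwichTwo_EIEE e hK m₁ h₂ h₄, zero_mulVec, dotProduct_zero]

/-- Three environment indices: `²D(V_K ψ)_{(m₁,m₃),(ej,m₄)} = 0`. [cite: KoridonEtAl2021, App. A eqs. (A2)-(A3) (projection onto |Φ_frozen Φ_active⟩)] -/
theorem twoRDM_frozenEmbed_mulVec_EEEI (hK : Disjoint K (rangeF e)) (ψ : Fock ι) (j : ι) {m₁ m₃ m₄ : ι'}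
    (h₁ : m₁ ∉ rangeF e) (h₃ : m₃ ∉ rangeF e) (h₄ : m₄ ∉ rangeF e) :
    twoRDM (frozenEmbed e K *ᵥ ψ) (m₁, m₃) (e j, m₄) = 0 := by
  simp only [twoRDM, expect_frozenEmbed, sandwichTwo_EEEI e hK h₁ h₃ h₄, zero_mulVec, dotProduct_zero]

/-- Three environment indices: `²D(V_K ψ)_{(ei,m₃),(m₂,m₄)} = 0`. [cite: KoridonEtAl2021, App. A eqs. (A2)-(A3) (projection onto |Φ_frozen Φ_active⟩)] -/
theorem twoRDM_frozenEmbed_mulVec_IEEE (hK : Disjoint K (rangeF e)) (ψ : Fock ι) (i : ι) (m₃ : ι')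
    {m₂ m₄ : ι'} (h₂ : m₂ ∉ rangeF e) (h₄ : m₄ ∉ rangeF e) :
    twoRDM (frozenEmbed e K *ᵥ ψ) (e i, m₃) (m₂, m₄) = 0 := by
  simp only [twoRDM, expect_frozenEmbed, sandwichTwo_IEEE e hK m₃ h₂ h₄, zero_mulVec, dotProduct_zero]

end Literature.MathematicalPhysics.QuantumChemistry

end
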